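import Mathlib
import Summits.ValiantsHypothesis.ValiantsHypothesis.Theorems.NewtonUnitEquationsDissociatedUniformTotalsLawAngularCones
import HarnessLib

/-!
# Crux `NewtonUnitEquations.DissociatedUniform` (stmt-ValiantsHypothesis-5905): ONE LAP — the exterior angles of a strictly convex
# counter-clockwise polygon sum to exactly `2π`, and the integer cone-index lift of a weak top

Memo `Cruxes/DissociatedUniform/NOTES-t1g8.md` §5(i).  Continuing `…TotalsLawAngularCones` (angle sequence `ω = coneAngle c t₀` of the
outward normals; closed tile ⇒ weak top; open tile ⇒ unique weak top):

* **`coneAngle_lap`**: `ω q = ω 0 + 2π` (the lap is a positive multiple of `2π` since `nrm c q = nrm c 0`; a second lap would put the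
  direction of the open tile `(ω 0, ω 1)` into a tile `[ω k, ω (k+1)]`, `0 < k < q`, of a DIFFERENT vertex — contradicting uniqueness);
  `coneAngle_add_q`, `coneAngle_add_mul` (`ω (k + qn) = ω k + 2πn`);
* **`exists_lift_of_wTop`**: a weak top `z` at the direction of angle `t ≥ ω q` has a LIFT `i : ℕ`, `i ≥ q`, `i ≡ z (mod q)`, with
  `ω (i − 1) ≤ t ≤ ω i` — the monotone cone index of the crossing-number count;
* packaged for consumers as **`exists_coneAngles`** (`∃ ω` strictly increasing, `q`-periodic up to `2π`, with the lift property).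
Honest label: plane geometry; nothing here bears on VP ≠ VNP.
[folklore: the exterior angles of a convex polygon sum to 2π]
-/

set_option linter.dupNamespace false -- `ValiantsHypothesis.ValiantsHypothesis` (summit = problem) in every name

open scoped BigOperators

namespace Summit.ValiantsHypothesis.ValiantsHypothesis.Theorems.NewtonUnitEquationsDissociatedUniform

namespace TotalsLaw

open Matrix Real

section OneLap

variable {q : ℕ}

/-- Locating a real number in the steps of a sequence. [folklore] -/
theorem exists_step_of_le (ω : ℕ → ℝ) (N : ℕ) {t : ℝ} (h0 : ω 0 ≤ t) (hN : t ≤ ω (N + 1)) :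
    ∃ k, k ≤ N ∧ ω k ≤ t ∧ t ≤ ω (k + 1) := by
  induction N with
  | zero => exact ⟨0, le_rfl, h0, hN⟩
  | succ N ih =>
    by_cases h : t ≤ ω (N + 1)
    · obtain ⟨k, hk, h1, h2⟩ := ih h
      exact ⟨k, by omega, h1, h2⟩
    · exact ⟨N + 1, le_rfl, (not_le.1 h).le, hN⟩

/-- Equal vectors in polar form have angles differing by a multiple of `2π`. [folklore] -/
theorem exists_int_of_smul_udir_eq {r r' a b : ℝ} (hr : 0 < r) (hr' : 0 < r') (h : r • udir a = r' • udir b) :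
    ∃ m : ℤ, a = b + m * (2 * π) := by
  have h0 : r * Real.cos a = r' * Real.cos b := by simpa [udir] using congrArg (fun v => v 0) h
  have h1 : r * Real.sin a = r' * Real.sin b := by simpa [udir] using congrArg (fun v => v 1) h
  have hrr : r = r' := by
    have e : r ^ 2 = r' ^ 2 := by
      calc r ^ 2 = r ^ 2 * (Real.cos a ^ 2 + Real.sin a ^ 2) := by rw [Real.cos_sq_add_sin_sq, mul_one]
        _ = (r * Real.cos a) ^ 2 + (r * Real.sin a) ^ 2 := by ring
        _ = (r' * Real.cos b) ^ 2 + (r' * Real.sin b) ^ 2 := by rw [h0, h1]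
        _ = r' ^ 2 * (Real.cos b ^ 2 + Real.sin b ^ 2) := by ring
        _ = r' ^ 2 := by rw [Real.cos_sq_add_sin_sq, mul_one]
    exact (sq_eq_sq₀ hr.le hr'.le).1 e
  subst hrr
  have hc : Real.cos a = Real.cos b := mul_left_cancel₀ hr.ne' h0
  have hs : Real.sin a = Real.sin b := mul_left_cancel₀ hr.ne' h1
  obtain ⟨m, hm⟩ := Real.Angle.angle_eq_iff_two_pi_dvd_sub.1 (Real.Angle.cos_sin_inj hc hs)
  exact ⟨m, by linarith⟩

/-- **ONE LAP.**  The angle sequence advances by exactly `2π` over `q` edges. [folklore] -/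
theorem coneAngle_lap {c : ZMod q → (Fin 2 → ℝ)} (hc : StrictlyConvexCcw c) (hq : 3 ≤ q) {t₀ r₀ : ℝ} (hr₀ : 0 < r₀)
    (h0 : nrm c 0 = r₀ • udir t₀) : coneAngle c t₀ q = coneAngle c t₀ 0 + 2 * π := by
  have hmono := coneAngle_strictMono hc hq hr₀ h0
  -- the lap is a multiple of 2π
  obtain ⟨r, hr, hrq⟩ := nrm_eq_smul_udir hc hq hr₀ h0 q
  have hnq : nrm c q = nrm c 0 := by simpa using nrm_add_q c 0
  rw [hnq, h0] at hrq
  obtain ⟨m, hm⟩ := exists_int_of_smul_udir_eq hr hr₀ hrq.symm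
  have hω0 : coneAngle c t₀ 0 = t₀ := rfl
  -- at least one lap
  have hpos : coneAngle c t₀ 0 < coneAngle c t₀ q := hmono (by omega)
  have hm1 : 1 ≤ m := by
    by_contra hlt
    have : (m : ℝ) ≤ 0 := by exact_mod_cast (show m ≤ 0 by omega)
    nlinarith [Real.pi_pos]
  -- at most one lap
  have hm2 : m ≤ 1 := by
    by_contra hgt
    have hm2' : (2 : ℝ) ≤ m := by exact_mod_cast (show 2 ≤ m by omega)
    obtain ⟨h01, h01'⟩ := coneAngle_step hc hq hr₀ h0 0
    set t := (coneAngle c t₀ 0 + coneAngle c t₀ 1) / 2 with ht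
    have ht0 : coneAngle c t₀ 0 < t := by rw [ht]; linarith
    have ht1 : t < coneAngle c t₀ (0 + 1) := by rw [ht]; linarith
    have hq1 : q - 1 + 1 = q := by omega
    obtain ⟨k, hk, hk1, hk2⟩ := exists_step_of_le (coneAngle c t₀) (q - 1) (t := t + 2 * π)
      (by linarith [Real.pi_pos]) (by rw [hq1]; nlinarith [Real.pi_pos])
    have hw : WTop c (udir t) ((k + 1 : ℕ) : ZMod q) := by
      have := wTop_udir_of_mem_tile hc hq hr₀ h0 k hk1 hk2
      rwa [show t + 2 * π = t + ((1 : ℤ) : ℝ) * (2 * π) by push_cast; ring, udir_add_int_mul] at this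
    have hk0 : ((k + 1 : ℕ) : ZMod q) = ((0 + 1 : ℕ) : ZMod q) := eq_of_wTop_of_mem_openTile hc hq hr₀ h0 0 ht0 ht1 hw
    have hkz : (k : ZMod q) = 0 := by
      push_cast at hk0; simpa using hk0
    have hk00 : k = 0 := Nat.eq_zero_of_dvd_of_lt ((ZMod.natCast_eq_zero_iff k q).1 hkz) (by omega)
    subst hk00
    linarith [Real.pi_pos]
  have hm_one : (m : ℝ) = 1 := by exact_mod_cast le_antisymm hm2 hm1
  rw [hm_one, one_mul] at hm
  rw [hω0]; exact hm

/-- `ω (k + q) = ω k + 2π`. [folklore] -/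
theorem coneAngle_add_q {c : ZMod q → (Fin 2 → ℝ)} (hc : StrictlyConvexCcw c) (hq : 3 ≤ q) {t₀ r₀ : ℝ} (hr₀ : 0 < r₀)
    (h0 : nrm c 0 = r₀ • udir t₀) (k : ℕ) : coneAngle c t₀ (k + q) = coneAngle c t₀ k + 2 * π := by
  have := coneAngle_add_q_sub c t₀ k
  rw [coneAngle_lap hc hq hr₀ h0] at this
  linarith

/-- `ω (k + q n) = ω k + 2π n`. [folklore] -/
theorem coneAngle_add_mul {c : ZMod q → (Fin 2 → ℝ)} (hc : StrictlyConvexCcw c) (hq : 3 ≤ q) {t₀ r₀ : ℝ} (hr₀ : 0 < r₀)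
    (h0 : nrm c 0 = r₀ • udir t₀) (k n : ℕ) : coneAngle c t₀ (k + q * n) = coneAngle c t₀ k + n * (2 * π) := by
  induction n with
  | zero => simp
  | succ n ih =>
    rw [show k + q * (n + 1) = (k + q * n) + q by ring, coneAngle_add_q hc hq hr₀ h0, ih]
    push_cast; ring

/-- **The cone-index lift of a weak top.**  A weak top `z` at the direction of angle `t ≥ ω q` has a lift `i : ℕ`, `i ≥ q`,
`i ≡ z (mod q)`, with `ω (i − 1) ≤ t ≤ ω i`. [folklore] -/
theorem exists_lift_of_wTop {c : ZMod q → (Fin 2 → ℝ)} (hc : StrictlyConvexCcw c) (hq : 3 ≤ q) {t₀ r₀ : ℝ} (hr₀ : 0 < r₀)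
    (h0 : nrm c 0 = r₀ • udir t₀) {t : ℝ} {z : ZMod q} (ht : coneAngle c t₀ q ≤ t) (hw : WTop c (udir t) z) :
    ∃ i : ℕ, q ≤ i ∧ (i : ZMod q) = z ∧ coneAngle c t₀ (i - 1) ≤ t ∧ t ≤ coneAngle c t₀ i := by
  haveI : NeZero q := ⟨by omega⟩
  have hmono := coneAngle_strictMono hc hq hr₀ h0
  set k := z.val with hk
  have hkq : k < q := ZMod.val_lt z
  have hkz : (k : ZMod q) = z := ZMod.natCast_zmod_val z
  set K := k + q with hK
  have hK1 : 1 ≤ K := by omega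
  have hKz : ((K : ℕ) : ZMod q) = z := by rw [hK]; push_cast; rw [hkz, ZMod.natCast_self, add_zero]
  have hK1z : (((K - 1 : ℕ)) : ZMod q) = z - 1 := by
    rw [show K - 1 = k + (q - 1) by omega]; push_cast [Nat.cast_sub (show 1 ≤ q by omega)]
    rw [hkz, ZMod.natCast_self]; ring
  -- the two normals of the vertex `z` in polar form
  obtain ⟨r₁, hr₁, e₁⟩ := nrm_eq_smul_udir hc hq hr₀ h0 (K - 1)
  obtain ⟨hβ0, hβπ, r₂, hr₂, e₂⟩ := relAngle_spec hr₁ e₁ (cross2_nrm_pos hc hq (K - 1))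
  set β := relAngle (nrm c (K - 1)) (nrm c (K - 1 + 1)) with hβ
  have hK11 : K - 1 + 1 = K := by omega
  have hωK : coneAngle c t₀ K = coneAngle c t₀ (K - 1) + β := by
    conv_lhs => rw [← hK11]
    rfl
  have hp1 : perp (edgeVec c (z - 1)) = r₁ • udir (coneAngle c t₀ (K - 1)) := by rw [← e₁, nrm, hK1z]
  have hp2 : perp (edgeVec c z) = r₂ • udir (coneAngle c t₀ (K - 1) + β) := by rw [← e₂, nrm, hK11, hKz]
  -- the weight in the cone
  obtain ⟨lam, hlam, ρ, hρ, hθ⟩ := exists_conePath_of_wTop hc hq z (udir_ne_zero t) hw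
  have hcombo : (1 : ℝ) • udir t =
      (ρ * ((1 - lam) * r₁)) • udir (coneAngle c t₀ (K - 1)) + (ρ * (lam * r₂)) • udir (coneAngle c t₀ (K - 1) + β) := by
    rw [one_smul, hθ, conePath, hp1, hp2]
    simp only [smul_add, smul_smul]
  obtain ⟨m, hm1, hm2⟩ := exists_rep_mem_Icc_of_combo hβ0 hβπ one_pos
    (mul_nonneg hρ.le (mul_nonneg (by linarith [hlam.2]) hr₁.le)) (mul_nonneg hρ.le (mul_nonneg hlam.1 hr₂.le)) hcombo
  rw [← hωK] at hm2
  -- the period count `m` is non-negative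
  have hKlt : coneAngle c t₀ K < coneAngle c t₀ q + 2 * π := by
    rw [← coneAngle_add_q hc hq hr₀ h0 q]
    exact hmono (by omega)
  have hm0 : 0 ≤ m := by
    by_contra hneg
    have : (m : ℝ) ≤ -1 := by exact_mod_cast (show m ≤ -1 by omega)
    nlinarith [Real.pi_pos]
  obtain ⟨n, hn⟩ := Int.eq_ofNat_of_zero_le hm0
  have hmn : (m : ℝ) = n := by rw [hn]; rfl
  refine ⟨K + q * n, by omega, ?_, ?_, ?_⟩
  · push_cast; rw [hKz, ZMod.natCast_self, zero_mul, add_zero]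
  · rw [show K + q * n - 1 = (K - 1) + q * n by omega, coneAngle_add_mul hc hq hr₀ h0, ← hmn]
    linarith
  · rw [coneAngle_add_mul hc hq hr₀ h0, ← hmn]
    linarith

/-- `perp v = 0` only for `v = 0`. [folklore] -/
theorem perp_ne_zero {v : Fin 2 → ℝ} (hv : v ≠ 0) : perp v ≠ 0 := by
  intro h
  apply hv
  have h0 : v 1 = 0 := by simpa [perp] using congrArg (fun w => w 0) h
  have h1 : v 0 = 0 := by simpa [perp] using congrArg (fun w => w 1) h
  ext i; fin_cases i <;> simp [h0, h1]

/-- **ANGULAR CONES, packaged.**  A strictly convex ccw polygon (`q ≥ 3`) has a strictly increasing angle sequence `ω : ℕ → ℝ` with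
`ω (k + q) = ω k + 2π` such that every weak top `z` at a direction of angle `t ≥ ω q` has a lift `i ≥ q`, `i ≡ z`, `ω (i−1) ≤ t ≤ ω i`.
[folklore] -/
theorem exists_coneAngles {c : ZMod q → (Fin 2 → ℝ)} (hc : StrictlyConvexCcw c) (hq : 3 ≤ q) :
    ∃ ω : ℕ → ℝ, StrictMono ω ∧ (∀ k, ω (k + q) = ω k + 2 * π) ∧
      ∀ (t : ℝ) (z : ZMod q), ω q ≤ t → WTop c (udir t) z →
        ∃ i : ℕ, q ≤ i ∧ (i : ZMod q) = z ∧ ω (i - 1) ≤ t ∧ t ≤ ω i := by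
  have hne : nrm c 0 ≠ 0 := by
    refine perp_ne_zero fun h => ?_
    have := cross2_edgeVec_pos hc hq 0
    rw [Nat.cast_zero] at h
    rw [h] at this
    simp [cross2] at this
  obtain ⟨r₀, hr₀, t₀, h0⟩ := exists_polar hne
  exact ⟨coneAngle c t₀, coneAngle_strictMono hc hq hr₀ h0, coneAngle_add_q hc hq hr₀ h0,
    fun t z ht hw => exists_lift_of_wTop hc hq hr₀ h0 ht hw⟩

end OneLap

end TotalsLaw

end Summit.ValiantsHypothesis.ValiantsHypothesis.Theorems.NewtonUnitEquationsDissociatedUniform
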